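import Mathlib
import Summits.Ventures.FusionMHD.Models.CerfonFreidbergIterLikeQ90Defs
import HarnessLib

/-!
# Ventures/FusionMHD — Models/CerfonFreidbergIterLikeQ90Panels1.lean: KERNEL CHECK of panels 0, 1 (of 32) of the
# certified safety factor `q(ψ_N = 9/10)/F` of THE Cerfon–Freidberg ITER-like instance (sibling of `…IterLikeQHalfPanels*.lean`)

HONEST FRAMING (LADDER-GRIDFUSION three columns; CF rung, F2 item R2, q-profile sample).  One `decide +kernel` (≈ 103 s on the farm): for
each panel `j` listed, the per-panel obligation `CFIterLike.Q90.PanelCert.ok` (`Models/CerfonFreidbergIterLikeQ90Defs.lean`) — the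
Taylor-model run of `CFIterLike.Q90.progG` over the ITER-like parameter box is ACCEPTED (every `log`/`sin`/`cos` composition and the `inv`
certificate), and the kernel's panel-integral enclosure of the polar `(6.35)` integrand along the approximant, the range of the flux residual
`U(ray m) − U_a/10`, the range of the approximant `m` and the range of the radial derivative `D_r(θ, m)` lie inside the integers claimed in
`panelCert1` (values read off a compiled `#eval` of the same functions, slack one unit of `2⁻⁶⁰`; probe `QProbeIF*.lean`, generator
`pub/gridfusion/models/gen-model-5/g8/gen90/mkdefsN.py`).  What these Booleans MEAN (real-number statements, uniformly over the parameter box ∋ THE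
ITER-like instance) is proved once in `Models/CerfonFreidbergIterLikeQ90Sound.lean`.  MODELLED: analytic Cerfon–Freidberg family; `q` of a
MODEL surface — nothing about a device or stability.  No `native_decide`.  Typer/prover: gridfusion-model-5 (g8), 2026-08-27.
Citations: Freidberg 2014 §6.3.5 (6.35) [Freidberg2014]; Mahboubi–Melquiond–Sibut-Pinote 2016 §3.2 Lemma 3 [MahboubiMelquiondSibutpinote2016].
-/

namespace Summit.Ventures.FusionMHD.Models.CFIterLike.Q90

/-- The certificate data of panels 0, 1 (`ψ_N = 9/10`): `inv` candidate (degree-12 fit of `(X·D_r)⁻¹` in the panel variable, scaled by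
`2⁶⁰`), Taylor degree, `inv` widening `2^elog2`, and the claimed integral / residual / `m`-range / `D_r`-range integers (× `2⁶⁰`). [instance data] -/
def panelCert1 : List PanelCert := [
  { j := 0, cand := [3165639837118559232, 224004917761704736, 7187364655838328832, 1230898182479910912, 19823705453637189632, 4678839962380638208, 66395346628442537984, 2561074094113853276160, -152699658418351771746304, -9615725579336322941714432, 659387302861463767775969280, 13769912340765943526049447936, -1001059317008127775838987878400],
    deg := 14, elog2 := 36, plo := 81424731538118629, phi := 81424735535382100, eta := 654779960, mlo := 301427426955047063, mhi := 302467118164906212,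
    dlo := 320847907722253712, dhi := 321669913454369851 },
  { j := 1, cand := [3179715569477893632, 679274662958534912, 7421214246621962240, 3790943846970207744, 21412808862267449344, 15562958825874915328, 60558924051405717504, 97379711845489065984, 530377384925403938816, -105174857633146712621056, -2550627307556827985608704, 128643284909948623191539712, 4053043331195971266934734848],
    deg := 12, elog2 := 34, plo := 82163761025075230, phi := 82163762103074547, eta := 267772760, mlo := 302114871278999121, mhi := 304556714777987669,
    dlo := 319200050659948903, dhi := 321124054501137828 }]

/-- **KERNEL CHECK** of panels 0, 1 of the ITER-like surface `ψ_N = 9/10`. -/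
theorem panelCert1_ok : CFIterLike.Q90.panelCert1.all PanelCert.ok = true := by
  decide +kernel

end Summit.Ventures.FusionMHD.Models.CFIterLike.Q90
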